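import Summits.CriticalPhenomena.PercolationContinuityZ3.Theorems.Transplant.Z3ChiralDozen
import Summits.CriticalPhenomena.PercolationContinuityZ3.Theorems.Transplant.StatementPolynomialGrowth
import Summits.CriticalPhenomena.PercolationContinuityZ3.Theorems.Transplant.StatementBenjaminiSchramm
import Literature.Barriers.CriticalPhenomena.SubexponentialGrowthZdBurtonKeane
import Literature.Probability.LatticeModels.ThermodynamicLimit
import HarnessLib

/-!
# Every unit-range `Cay(ℤ³; S)` (symmetric short `S ⊇ {±eᵢ}` — the 1,024-member family `UnitGens`, in particular the chiral dozen `X⋆`)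
# has cubic growth, is amenable, carries a unique infinite cluster at every density, and meets every hypothesis of Benjamini–Schramm's
# Conjecture 4 — so its `θ(p_c) = 0` is an instance of the conjecture's OPEN residue (amenable, subexponential), outside Hutchcroft 2016

builds on p205010 (kernel theorem, internal audit signed; external expert review pending) — nothing in this file uses p205010.
Lane `prim-bschramm`, seat `prim-bschramm-p1` (gen 12), N1 programme (the `{±1}` node `SamePDropOfSkeletonNeg₁`; customers file
`SkeletonNeg1Customers`): the SCOPE certificate of the N1 customers — what class of Conjecture 4 the family lies in — written before the node
closes, as `StackedTriangularScope` (stmt-g4) was for `𝕋 × ℤ` and `CubicLatticesAmenable` (stmt) for fcc/bcc; PROOFS ONLY, generic in `U : UnitGens`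
(helper file, `--supports stmt-CriticalPhenomena-4575 --as helper`).
* §1 cubic growth: along a walk of length `n` every coordinate moves by `≤ n` (`U.abs_sub_le_of_adj`), so `|B(x,n)| ≤ (2n+1)³`
  (`UnitGens.ballVolume_le`), uniform polynomial growth (`C = 8`, `D = 3`), NO exponential growth;
* §2 `Aut`-transitivity in Mathlib's spelling (`MulAction.IsPretransitive (U.graph ≃g U.graph) (Site 3)`), amenability (Lyons–Peres §6.1
  contrapositive, tree `hasExponentialGrowth_of_not_isGraphAmenable`), uniqueness of the infinite cluster at EVERY density (Burton–Keane, tree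
  `BurtonKeane1989_atMostOneInfiniteCluster_holds`) — the uniqueness input of the N1 node is thus automatic on the whole family;
* §3 `UnitGens.in_scope`: the family meets every hypothesis of Conjecture 4 (connected, transitive, `p_c < 1`) with cubic growth — hence each
  `θ_{Cay(ℤ³;S)}(p_c) = 0` follows from `BenjaminiSchramm1996_conj4`, from its polynomial-growth spelling and from its amenable-subexponential
  residue (`UnitGens.criticalContinuity_of_conj4(_polynomialGrowth/_amenableSubexponential)`), and is NOT an instance of Hutchcroft's
  exponential-growth theorem nor of BLPS (non-amenable);
* §4 the same for `X⋆ = Cay(ℤ³; S⋆)` by specialisation (`Z3Chiral.ballVolume_le`, `Z3Chiral.in_scope` — amenability, uniqueness and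
  subexponential growth as conjuncts —, `Z3Chiral.criticalContinuity_of_conj4(_amenableSubexponential)`).
[cite: BenjaminiSchramm1996, Conj. 4 and §2] [cite: LyonsPeres2016, §6.1 (p. 279), Thm. 7.6] [cite: BurtonKeane1989, Thm. 2]
[cite: Hutchcroft2016, Thm. 1] [cite: GrimmettPercolation1999, §12.1 p. 349]
-/

noncomputable section

namespace Summit.CriticalPhenomena.PercolationContinuityZ3.Theorems.Transplant

open MeasureTheory Filter Literature.Probability.Percolation Literature.Probability.LatticeModels SimpleGraph
open Literature.Barriers.CriticalPhenomena (IsQuasiTransitive IsGraphTransitive IsGraphAmenable HasExponentialGrowth graphBall ballVolume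
  hasExponentialGrowth_of_not_isGraphAmenable eventually_pow_lt_const_pow BurtonKeane1989_atMostOneInfiniteCluster_holds)
open scoped Classical

namespace UnitGens

variable (U : UnitGens)

/-! ## §1 Cubic growth -/

/-- Along a walk of length `n` in `Cay(ℤ³; S)` every coordinate moves by at most `n` (unit range of `S`). [folklore] -/
theorem abs_sub_le_length {x y : Site 3} (w : U.graph.Walk x y) (i : Fin 3) : |y i - x i| ≤ (w.length : ℤ) := by
  induction w with
  | nil => simp
  | @cons a b c hab w ih =>
    have h1 : |b i - a i| ≤ 1 := U.abs_sub_le_of_adj hab i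
    have h2 : |c i - a i| ≤ |c i - b i| + |b i - a i| := by
      have := abs_sub_le (c i) (b i) (a i); linarith
    simp only [SimpleGraph.Walk.length_cons, Nat.cast_add, Nat.cast_one]
    linarith

/-- **Cubic growth of every unit-range `Cay(ℤ³; S)`**: `|B(x,n)| ≤ (2n+1)³` (the ball, translated by `−x`, injects into the box `Λ_n`).
[cite: LyonsPeres2016, §6.1 (growth of balls)] -/
theorem ballVolume_le (x : Site 3) (n : ℕ) : ballVolume U.graph x n ≤ (2 * n + 1) ^ 3 := by
  set f : Site 3 → Site 3 := fun y => y - x with hf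
  have hinj : Function.Injective f := fun y z h => sub_left_injective h
  have hsub : f '' graphBall U.graph x n ⊆ (↑(box 3 n) : Set (Site 3)) := by
    rintro _ ⟨y, ⟨w, hw⟩, rfl⟩
    rw [Finset.mem_coe, mem_box]
    intro i
    have h := U.abs_sub_le_length w i
    have hn : (w.length : ℤ) ≤ n := by exact_mod_cast hw
    simp only [hf, Pi.sub_apply]
    constructor <;> linarith [(abs_le.1 (h.trans hn)).1, (abs_le.1 (h.trans hn)).2]
  unfold ballVolume
  rw [← Set.ncard_image_of_injective _ hinj, ← card_box 3 n, ← Set.ncard_coe_finset]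
  exact Set.ncard_le_ncard hsub (box 3 n).finite_toSet

/-- Uniform polynomial growth of every unit-range `Cay(ℤ³; S)` (`C = 8`, `D = 3`). [cite: LyonsPeres2016, §6.1] -/
theorem polynomialGrowth : ∃ C D : ℝ, ∀ (x : Site 3) (n : ℕ), (ballVolume U.graph x n : ℝ) ≤ C * ((n : ℝ) + 1) ^ D := by
  refine ⟨8, ((3 : ℕ) : ℝ), fun x n => ?_⟩
  rw [Real.rpow_natCast]
  have h1 : (ballVolume U.graph x n : ℝ) ≤ (2 * n + 1) ^ 3 := by exact_mod_cast U.ballVolume_le x n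
  have h2 : ((2 : ℝ) * n + 1) ^ 3 ≤ 8 * ((n : ℝ) + 1) ^ 3 := by
    have : (2 : ℝ) * n + 1 ≤ 2 * ((n : ℝ) + 1) := by linarith
    calc ((2 : ℝ) * n + 1) ^ 3 ≤ (2 * ((n : ℝ) + 1)) ^ 3 := pow_le_pow_left₀ (by positivity) this 3
      _ = 8 * ((n : ℝ) + 1) ^ 3 := by ring
  exact h1.trans h2

/-- **No unit-range `Cay(ℤ³; S)` has exponential growth** — the family lies OUTSIDE Hutchcroft's theorem. [cite: Hutchcroft2016, Thm. 1] -/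
theorem not_hasExponentialGrowth : ¬ HasExponentialGrowth U.graph := by
  intro h
  obtain ⟨c, hc, hev⟩ := h (0 : Site 3)
  obtain ⟨n, hn1, hn2⟩ := (hev.and (eventually_pow_lt_const_pow 3 hc)).exists
  have hvol : (ballVolume U.graph (0 : Site 3) n : ℝ) ≤ (2 * n + 1) ^ 3 := by exact_mod_cast U.ballVolume_le _ n
  linarith

/-! ## §2 Transitivity (Mathlib spelling), amenability, uniqueness of the infinite cluster -/

/-- `Aut(Cay(ℤ³; S))` acts transitively on the vertices, in Mathlib's spelling (the translations `U.shift`). [cite: BenjaminiSchramm1996, §2] -/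
theorem isPretransitive_aut : MulAction.IsPretransitive (U.graph ≃g U.graph) (Site 3) :=
  (isPretransitive_aut_iff U.graph).2 U.graph_transitive

/-- **Every unit-range `Cay(ℤ³; S)` is amenable** (subexponential growth; Lyons–Peres §6.1 contrapositive). [cite: LyonsPeres2016, §6.1 (p. 279)] -/
theorem isGraphAmenable : IsGraphAmenable U.graph := by
  by_contra h
  exact U.not_hasExponentialGrowth (hasExponentialGrowth_of_not_isGraphAmenable _ U.graph_quasiTransitive h)

/-- **Uniqueness of the infinite cluster on every unit-range `Cay(ℤ³; S)` at every density** (Burton–Keane for connected quasi-transitive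
amenable graphs, tree). [cite: BurtonKeane1989, Thm. 2] [cite: LyonsPeres2016, Thm. 7.6] -/
theorem numInfiniteClusters_le_one (p : unitInterval) : ∀ᵐ ω ∂(bondPercolation U.graph p), numInfiniteClusters ω ≤ 1 :=
  BurtonKeane1989_atMostOneInfiniteCluster_holds _ U.graph_connected U.graph_quasiTransitive U.isGraphAmenable p

/-! ## §3 In scope of Conjecture 4, outside the printed theorems -/

/-- **Every unit-range `Cay(ℤ³; S)` meets every hypothesis of Benjamini–Schramm's Conjecture 4, with cubic growth, amenability and uniqueness**:
connected, `Aut`-transitive (one orbit), `|B(x,n)| ≤ (2n+1)³`, no exponential growth, amenable, a.s. at most one infinite cluster at every `p`,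
and `0 ≤ p_c < 1`. [cite: BenjaminiSchramm1996, Conj. 4 and §2] [cite: LyonsPeres2016, §6.1, Thm. 7.6] [cite: BurtonKeane1989, Thm. 2] -/
theorem in_scope :
    U.graph.Connected ∧ MulAction.IsPretransitive (U.graph ≃g U.graph) (Site 3) ∧ IsQuasiTransitive U.graph ∧
      (∀ (x : Site 3) (n : ℕ), ballVolume U.graph x n ≤ (2 * n + 1) ^ 3) ∧ ¬ HasExponentialGrowth U.graph ∧ IsGraphAmenable U.graph ∧
      (∀ p : unitInterval, ∀ᵐ ω ∂(bondPercolation U.graph p), numInfiniteClusters ω ≤ 1) ∧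
      0 ≤ criticalProb U.graph (0 : Site 3) ∧ criticalProb U.graph (0 : Site 3) < 1 :=
  ⟨U.graph_connected, U.isPretransitive_aut, U.graph_quasiTransitive, U.ballVolume_le, U.not_hasExponentialGrowth, U.isGraphAmenable,
    U.numInfiniteClusters_le_one, (criticalProb_mem_Icc U.graph (0 : Site 3)).1, U.criticalProb_lt_one⟩

/-- `p_c < 1` at every vertex of `Cay(ℤ³; S)` (transport along the translations). [cite: BenjaminiSchramm1996, Thm. 1] -/
theorem criticalProb_lt_one' (v : Site 3) : criticalProb U.graph v < 1 := by
  have hpc := criticalProb_iso (U.shift v) (0 : Site 3)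
  have hv : U.shift v 0 = v := by simp
  rw [hv] at hpc
  rw [hpc]; exact U.criticalProb_lt_one

/-- Conjecture 4 implies `θ(p_c) = 0` at every vertex of every unit-range `Cay(ℤ³; S)`. [cite: BenjaminiSchramm1996, Conj. 4] -/
theorem criticalContinuity_of_conj4 (h : BenjaminiSchramm1996_conj4) (v : Site 3) : theta U.graph v (criticalProbIOf U.graph v) = 0 :=
  h U.graph U.graph_connected U.graph_quasiTransitive v (U.criticalProb_lt_one' v)

/-- The polynomial-growth spelling of Conjecture 4 implies `θ(p_c) = 0` on every unit-range `Cay(ℤ³; S)`. [cite: BenjaminiSchramm1996, Conj. 4] -/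
theorem criticalContinuity_of_conj4_polynomialGrowth (h : BenjaminiSchramm1996_conj4_polynomialGrowth) (v : Site 3) :
    theta U.graph v (criticalProbIOf U.graph v) = 0 :=
  h U.graph U.graph_connected U.graph_quasiTransitive U.polynomialGrowth v (U.criticalProb_lt_one' v)

/-- **The amenable-subexponential residue of Conjecture 4 (the part OPEN in print) implies `θ(p_c) = 0` on every unit-range `Cay(ℤ³; S)`** —
the family lies in the residue, not in Hutchcroft's / BLPS's classes. [cite: BenjaminiSchramm1996, Conj. 4] [cite: Hutchcroft2016, Thm. 1] -/
theorem criticalContinuity_of_conj4_amenableSubexponential (h : BenjaminiSchramm1996_conj4_amenableSubexponential) (v : Site 3) :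
    theta U.graph v (criticalProbIOf U.graph v) = 0 :=
  h U.graph U.graph_connected U.graph_quasiTransitive U.isGraphAmenable U.not_hasExponentialGrowth v (U.criticalProb_lt_one' v)

end UnitGens

/-! ## §4 The chiral dozen `X⋆` -/

namespace Z3Chiral

/-- Cubic growth of `X⋆`: `|B(x,n)| ≤ (2n+1)³`. [cite: LyonsPeres2016, §6.1] -/
theorem ballVolume_le (x : Site 3) (n : ℕ) : ballVolume X x n ≤ (2 * n + 1) ^ 3 := Ustar.ballVolume_le x n

/-- **`X⋆` meets every hypothesis of Conjecture 4, with cubic growth, amenability and uniqueness.** [cite: BenjaminiSchramm1996, Conj. 4 and §2] -/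
theorem in_scope :
    X.Connected ∧ MulAction.IsPretransitive (X ≃g X) (Site 3) ∧ IsQuasiTransitive X ∧
      (∀ (x : Site 3) (n : ℕ), ballVolume X x n ≤ (2 * n + 1) ^ 3) ∧ ¬ HasExponentialGrowth X ∧ IsGraphAmenable X ∧
      (∀ p : unitInterval, ∀ᵐ ω ∂(bondPercolation X p), numInfiniteClusters ω ≤ 1) ∧
      0 ≤ criticalProb X (0 : Site 3) ∧ criticalProb X (0 : Site 3) < 1 :=
  Ustar.in_scope

/-- The amenable-subexponential residue of Conjecture 4 implies `θ_{X⋆}(p_c) = 0` at every vertex. [cite: BenjaminiSchramm1996, Conj. 4] -/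
theorem criticalContinuity_of_conj4_amenableSubexponential (h : BenjaminiSchramm1996_conj4_amenableSubexponential) (v : Site 3) :
    theta X v (criticalProbIOf X v) = 0 :=
  Ustar.criticalContinuity_of_conj4_amenableSubexponential h v

/-- Conjecture 4 implies `θ_{X⋆}(p_c) = 0` at every vertex. [cite: BenjaminiSchramm1996, Conj. 4] -/
theorem criticalContinuity_of_conj4 (h : BenjaminiSchramm1996_conj4) (v : Site 3) : theta X v (criticalProbIOf X v) = 0 :=
  Ustar.criticalContinuity_of_conj4 h v

end Z3Chiral

end Summit.CriticalPhenomena.PercolationContinuityZ3.Theorems.Transplant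

end
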